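import Mathlib
import Literature.RingTheory.RegularLocalRing.ParameterIdealSocle
import HarnessLib

set_option linter.dupNamespace false

/-!
# Cyclic socle of parameter ideals of complete-intersection quotients of regular local rings

Stub `stub_socle_cyclic_of_ci` of the skeleton `Sketch` for crux stmt-ResolutionOfSingularities-15317
(`FrobeniusLadder.FRationalResolution`, "F-rational ⇒ weakly F-regular" on the Gorenstein sector).
Let `(S, 𝔪_S)` be a regular local ring, `f : S → R` a surjective ring map onto a local ring `R` whose
kernel is generated by a list `G` with `G.length + d = dim S`, and `s : Fin d → R` elements generating
an ideal `q = (s)` with maximal radical. Then the socle of `R/q` is cyclic: `(q : 𝔪_R) = q + (t)` for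
some `t ∈ R`.

Proof. Lift `s` to `s̃ : Fin d → S` and put `Q = G ++ s̃`, a list of `dim S` elements of `𝔪_S` with
`f⁻¹(q) = (Q)` and `𝔪_S ^ N ⊆ (Q)` (pull back `𝔪_R ^ N ⊆ q`, which holds as `R` is Noetherian and
`rad q = 𝔪_R`). The tree's `Literature.RingTheory.RegularLocalRing.exists_colon_maximalIdeal_eq_sup_span`
(Matsumura 18.1: a regular local ring modulo a system of parameters has simple socle) gives
`((Q) : 𝔪_S) = (Q) + (u)`; since colon ideals commute with pulling back along the surjection `f`
(`comap_colon_eq_of_surjective`), pushing forward yields `(q : 𝔪_R) = q + (f u)`.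
-/

open IsLocalRing

namespace Summit.ResolutionOfSingularities.ResolutionOfSingularities.Theorems.FRationalResolution

/-- Colon ideals commute with pulling back along a surjective ring map:
`f⁻¹(I : J) = (f⁻¹ I : f⁻¹ J)`. -/
theorem comap_colon_eq_of_surjective {A B : Type*} [CommRing A] [CommRing B] (f : A →+* B)
    (hf : Function.Surjective f) (I J : Ideal B) :
    (I.colon (J : Set B)).comap f = (I.comap f).colon (J.comap f : Set A) := by
  ext x
  simp only [Ideal.mem_comap, Submodule.mem_colon, SetLike.mem_coe, smul_eq_mul]
  constructor
  · intro h y hy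
    rw [map_mul]
    exact h (f y) hy
  · intro h m hm
    obtain ⟨y, rfl⟩ := hf m
    rw [← map_mul]
    exact h y hm

/-- **Parameter ideals of complete-intersection quotients of a regular local ring have cyclic
socle.** For a regular local ring `S`, a surjection `f : S → R` onto a local ring with kernel
generated by a list `G`, `G.length + d = dim S`, and `s : Fin d → R` generating an ideal with maximal
radical, there is `t` with `((s) : 𝔪_R) = (s) + (t)` (lift `s`, apply Matsumura 18.1 in `S` to the
system of parameters `G ++ s̃`, and push forward along `f`). -/
theorem stub_socle_cyclic_of_ci (S R : Type) [CommRing S] [IsRegularLocalRing S] [CommRing R]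
    [IsLocalRing R] (f : S →+* R) (hf : Function.Surjective f) (G : List S)
    (hker : RingHom.ker f = Ideal.ofList G) (d : ℕ)
    (hdim : ((G.length + d : ℕ) : WithBot ℕ∞) = ringKrullDim S)
    (s : Fin d → R) (hs : (Ideal.span (Set.range s)).radical.IsMaximal) :
    ∃ t : R, (Ideal.span (Set.range s)).colon (IsLocalRing.maximalIdeal R : Set R) =
      Ideal.span (Set.range s) ⊔ Ideal.span {t} := by
  classical
  -- lifts of the parameters and the local-homomorphism bookkeeping
  choose s' hs' using fun i => hf (s i)
  haveI : IsLocalHom f := IsLocalHom.of_surjective f hf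
  have hcomap𝔪 : (maximalIdeal R).comap f = maximalIdeal S := IsLocalRing.maximalIdeal_comap f
  have hmap𝔪 : (maximalIdeal S).map f = maximalIdeal R :=
    IsLocalRing.map_maximalIdeal_of_surjective f hf
  -- (1) `f (Q) = (s)` and `f⁻¹ (s) = (Q)` for `Q = G ++ s̃`
  have hset : (f : S → R) '' {x | x ∈ List.ofFn s'} = Set.range s := by
    ext r
    simp only [Set.mem_image, Set.mem_setOf_eq, List.mem_ofFn', Set.mem_range]
    constructor
    · rintro ⟨x, ⟨i, rfl⟩, rfl⟩
      exact ⟨i, (hs' i).symm⟩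
    · rintro ⟨i, rfl⟩
      exact ⟨s' i, ⟨i, rfl⟩, hs' i⟩
  have hmapQ : (Ideal.ofList (G ++ List.ofFn s')).map f = Ideal.span (Set.range s) := by
    rw [Ideal.ofList_append, Ideal.map_sup, ← hker, (Ideal.map_eq_bot_iff_le_ker f).mpr le_rfl,
      bot_sup_eq, Ideal.ofList, Ideal.map_span, hset]
  have hcomapQ : (Ideal.span (Set.range s)).comap f = Ideal.ofList (G ++ List.ofFn s') := by
    rw [← hmapQ, Ideal.comap_map_of_surjective f hf, ← RingHom.ker_eq_comap_bot, hker,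
      Ideal.ofList_append]
    exact sup_eq_left.mpr le_sup_left
  -- (2) the members of `Q` are non-units
  have hI𝔪 : Ideal.span (Set.range s) ≤ maximalIdeal R :=
    Ideal.le_radical.trans (IsLocalRing.eq_maximalIdeal hs).le
  have hQ𝔪 : ∀ q ∈ G ++ List.ofFn s', q ∈ maximalIdeal S := fun q hq => by
    rw [← hcomap𝔪, Ideal.mem_comap]
    refine hI𝔪 ?_
    rw [← hmapQ]
    exact Ideal.mem_map_of_mem f (Ideal.subset_span hq)
  -- (3) `(Q)` is `𝔪_S`-primary
  haveI : IsNoetherianRing R := isNoetherianRing_of_surjective S R f hf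
  obtain ⟨N, hN⟩ := Ideal.exists_pow_le_of_le_radical_of_fg
    (IsLocalRing.eq_maximalIdeal hs).ge (IsNoetherian.noetherian (maximalIdeal R))
  have hN' : maximalIdeal S ^ N ≤ Ideal.ofList (G ++ List.ofFn s') := by
    rw [← hcomapQ, ← Ideal.map_le_iff_le_comap, Ideal.map_pow, hmap𝔪]
    exact hN
  -- (4) Matsumura 18.1 upstairs
  have hlen : ((G ++ List.ofFn s').length : WithBot ℕ∞) = ringKrullDim S := by
    rw [← hdim, List.length_append, List.length_ofFn]
  obtain ⟨u, hu⟩ :=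
    Literature.RingTheory.RegularLocalRing.exists_colon_maximalIdeal_eq_sup_span
      (G ++ List.ofFn s') hlen hQ𝔪 hN'
  -- (5) push down along `f`
  refine ⟨f u, ?_⟩
  rw [← Ideal.map_comap_of_surjective f hf ((Ideal.span (Set.range s)).colon _),
    comap_colon_eq_of_surjective f hf, hcomapQ, hcomap𝔪, hu, Ideal.map_sup, hmapQ,
    Ideal.map_span, Set.image_singleton]

end Summit.ResolutionOfSingularities.ResolutionOfSingularities.Theorems.FRationalResolution
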